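import Summits.ResolutionOfSingularities.ResolutionOfSingularities.Theorems.FrobeniusLadderFRationalResolutionFixedPointResolvableNhd
import Summits.ResolutionOfSingularities.ResolutionOfSingularities.Theorems.FrobeniusLadderFRationalResolutionFixedChart
import Mathlib.AlgebraicGeometry.Morphisms.Etale
import HarnessLib

/-!
# Crux `FrobeniusLadder.FRationalResolution` (stmt-ResolutionOfSingularities-15317), line `redirect`,
# stub `stub_diagonalizableQuotientResolution` — **TAME diagonalizable quotient singularities with
# regular charts are ÉTALE-LOCALLY RESOLVABLE over every field**

Under the hypothesis `hq` of `stub_diagonalizableQuotientResolution` (every point of `X/k` lies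
under an étale chart `Spec S₀ → X`, `S` REGULAR of finite type graded by a finite abelian group `A`)
strengthened by tameness (`|A| ∈ kˣ` chartwise): every `x ∈ X` admits an étale neighbourhood
`Spec T → X` (image containing `x`) whose source HAS A RESOLUTION OF SINGULARITIES. Assembly of
`…FixedChart.exists_fixed_chart` (tame ⇒ a chart at which the point is `D(A')`-FIXED) with
`…FixedPointResolvableNhd.exists_hasResolution_away_of_fixed` (a fixed point has a resolvable
neighbourhood `Spec (S'₀)_g`, Kato-log-regularity + Kato 1994 (10.4)); `T = (S'₀)_g` and the
neighbourhood is `Spec (S'₀)_g ↪ Spec S'₀ → X`.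

* **`exists_etale_nhd_hasResolution_of_hq_tame`** — the statement above.

Honest label: the CEILING of the log-regular line (census R3-tame + L3 + Kato): étale-local
resolvability, for all fields; the stub's `Scheme.HasResolution X` still needs the resolutions to
glue (functorial / destackification, Bergh–Rydh) and, without tameness, the non-fixed wild points.
No definitions, no named facts, no sorry. [cite: Kato1994, (10.4)]
[folklore; cite: SGA1, Exp. I Prop. 7.6; SGA3, Exp. VIII §4–5]
-/

noncomputable section

-- single-problem summit: the doubled namespace component is forced
set_option linter.dupNamespace false

open CategoryTheory AlgebraicGeometry Literature.AlgebraicGeometry.Resolution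

namespace Summit.ResolutionOfSingularities.ResolutionOfSingularities.Theorems.FRationalResolution.TameEtaleLocalResolution

/-- **A resolvable basic open of an étale chart is a resolvable étale neighbourhood.** If
`φ : Spec R → X` is étale, `v ∈ D(g) ⊆ Spec R`, and `Spec R_g` has a resolution, then `φ v` has the
étale neighbourhood `Spec R_g ↪ Spec R → X` with resolvable source. [folklore] -/
theorem exists_etale_nhd_of_away {R : Type} [CommRing R] (g : R) {X : Scheme.{0}}
    (φ : Spec (.of R) ⟶ X) [Etale φ] (v : Spec (.of R)) (hv : g ∉ v.asIdeal)
    (hres : Scheme.HasResolution (Spec (.of (Localization.Away g)))) :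
    ∃ (T : Type) (_ : CommRing T) (ψ : Spec (.of T) ⟶ X),
      Etale ψ ∧ φ v ∈ Set.range ψ ∧ Scheme.HasResolution (Spec (.of T)) := by
  refine ⟨Localization.Away g, inferInstance,
    Spec.map (CommRingCat.ofHom (algebraMap R (Localization.Away g))) ≫ φ, inferInstance, ?_, hres⟩
  have hvD : v ∈ (Spec.map (CommRingCat.ofHom (algebraMap R (Localization.Away g)))).opensRange := by
    rw [Scheme.Hom.opensRange_localizationAway (R := CommRingCat.of R) g]
    exact hv
  obtain ⟨u, hu⟩ := Scheme.Hom.mem_opensRange.mp hvD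
  exact ⟨u, by rw [Scheme.Hom.comp_apply, hu]⟩

/-- **Tame diagonalizable quotient singularities with regular charts are étale-locally resolvable
(every field).** Under `hq` with `|A|` invertible in `k` for each chart, every `x ∈ X` has an étale
neighbourhood `ψ : Spec T → X`, `x ∈ ψ(Spec T)`, with `Scheme.HasResolution (Spec T)`.
[cite: Kato1994, (10.4)] [folklore; cite: SGA1, Exp. I Prop. 7.6; SGA3, Exp. VIII §4–5] -/
theorem exists_etale_nhd_hasResolution_of_hq_tame (k : Type) [Field k] (X : Scheme.{0})
    (g : X ⟶ Spec (.of k))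
    (hq : ∀ x : X, ∃ (A : Type) (_ : AddCommGroup A) (_ : Finite A) (_ : DecidableEq A)
        (S : Type) (_ : CommRing S) (_ : Algebra k S) (𝒮 : A → Submodule k S)
        (_ : GradedAlgebra 𝒮), IsUnit ((Nat.card A : ℕ) : k) ∧ Algebra.FiniteType k S ∧
        IsRegularRing S ∧ ∃ φ : Spec (.of (𝒮 0)) ⟶ X, Etale φ ∧ x ∈ Set.range φ ∧
          φ ≫ g = Spec.map (CommRingCat.ofHom (algebraMap k (𝒮 0))))
    (x : X) :
    ∃ (T : Type) (_ : CommRing T) (ψ : Spec (.of T) ⟶ X),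
      Etale ψ ∧ x ∈ Set.range ψ ∧ Scheme.HasResolution (Spec (.of T)) := by
  classical
  obtain ⟨A, _, _, _, S, _, _, 𝒮, _, htame, hft, hreg, φ, hφ, ⟨v, hv⟩, hφg⟩ := hq x
  haveI := hft
  haveI := hreg
  haveI := hφ
  -- a chart at which the point is fixed
  obtain ⟨A', _, _, _, S', _, _, 𝒮', inst', hft', hreg', φ', hφ', hφ'g, v', 𝔔', h𝔔', h𝔔'v',
    hfix, hv'⟩ := FixedChart.exists_fixed_chart k X g A S 𝒮 φ hφg htame v
  haveI := hft'
  haveI := hreg'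
  haveI := h𝔔'
  haveI := hφ'
  have hA' : AddMonoid.IsTorsion A' := fun a => isOfFinAddOrder_of_finite a
  -- a resolvable basic open neighbourhood of the fixed point
  obtain ⟨g', hg', hres⟩ :=
    FixedPointResolvableNhd.exists_hasResolution_away_of_fixed 𝒮' hA' 𝔔' hfix
  have hv'g : g' ∉ v'.asIdeal := by
    rw [← h𝔔'v', Ideal.mem_comap]
    exact hg'
  rw [← hv, ← hv']
  exact exists_etale_nhd_of_away g' φ' v' hv'g hres

end Summit.ResolutionOfSingularities.ResolutionOfSingularities.Theorems.FRationalResolution.TameEtaleLocalResolution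

end
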